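import Literature.MathematicalPhysics.QuantumFieldTheory.Balaban1983to89.Node00.TransportOfRecordGaugeAE

/-!
# NODE 00 (YM-PLAN Track A) — THE Γ-AVERAGED CANONICAL-VERSION TRANSPORT `TinvOfRecord` («T♮»): the (0.13)∕(3.1) kernel transform read as a version that is
# GAUGE INVARIANT AT EVERY POINT FOR EVERY INPUT (average over the compact gauge group of `T^{(k+1)}`), then canonical (continuous on its maximal regular set) —
# OFFERED token; NO numerics, NO domain, NO proviso in the definition; every good property an unconditional theorem or conditional on the a.e.-class only

Cell `pub-ymgap`, NODE 00 territory, typed by WIDTH SEAT `pub-ymgap-dag-n09-w3` (g0) as a DRAFT on plan g78's word (YMPLAN-G78-WORDS-2, 2026-08-27: «(b) > (a) > (c); w3 take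
(b) = YES AS A DRAFT; file in the definition lane on node00-def-T's word») — the located cure option (b) of `HOME/pub-ymgap-dag-n09-w3/N09-ITEM3-MEMO.md` for N09's
Stage-13 residue (M1) ∕ (F7a) ∕ (F7b).  [I] = [Balaban1987RG1], [III] = [Balaban1988Convergent].  Imports this seat's theorems-only companion
`Node00/TransportOfRecordGaugeAE` (orbit averages ∕ the transform of record in a.e. currency; through it node00-def-K0e's FILE 6 `CanonicalTransportOfRecord` — `regSet`,
`canonVersion`, `TcanOfRecord`, its §4–§5 — and ym3-torus's `T3OrbitAverage` — `haarTransf`, `orbAvg`, `orbAvg_gaugeAct`, REUSED).  OFFERED to the type owner (node00-def-T)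
and the plan; defines NO record predicate and re-points NOTHING of record.  KNIT-BY-NAME; count-neutral; NOTHING of Bałaban's asserted.

WHY.  K0e's `TcanOfRecord K k ρ` (the Stage-13 token `TβOfRecord₁₃`) is gauge invariant only ON `regSetOfRecord K k ρ` and only for lift-invariant `ρ`
(`TcanOfRecord_gaugeAct_of_mem_regSet`); off the maximal regular set it is the kernel transform verbatim, a Radon–Nikodym-type version with no pointwise symmetry.  Hence
N09's Theorem-3 member at the v1.7 record displays (M1) lift-invariance of the (2.9) cut-off, (F7a) «supp χ_{i+1} ⊆ regSet_i» and (F7b) «averaged backgrounds ∈ regSet_i»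
(dag-n24-c `B12NodeKnitRecord13SepCoPH` §3).  Print's transform (0.13) has a gauge-INVARIANT KERNEL, so `Tρ` is invariant at every point for invariant `ρ` ([I] p. 254
«if ρ is a gauge invariant function, then Tρ is gauge invariant also»); over such a transport N09's member needs [B11] Thm 1 ONLY (tree:
`B12NodeKnitIndAPlug.thm3Member_of_indATPlug_of_liftCovariant`, dag-n09-e `B12HInvUnconditional`, dag-n09-w3 FILE 3 `…N09InvariantTransportPlug`).  THIS FILE builds a
version of the transform of record with print's pointwise symmetry and K0e's canonicity at once:
* §1 **`TinvOfRecord F N : Transport F N := fun K k ρ => canonVersion (piHaar …) (fun V => orbAvg (transportOfRecord F N K k ρ) V)`** (the kernel transform, ORBIT-AVERAGED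
  over the gauge group of `T^{(k+1)}`, then its canonical version).  FACES: **`TinvOfRecord_gaugeAct`** — `T♮ K k ρ (V^v) = T♮ K k ρ V` for EVERY `K`, `k`, `ρ`, `v`, `V` (no
  hypothesis: the orbit average is exactly invariant; its maximal regular set is gauge-stable and the canonical version inherits the symmetry on it, K0e §4; verbatim off it);
  hence **`gaugeInvariant_TinvOfRecord`** in the `Transport`-hypothesis shape dag-n09-w3 FILE 3 consumes (`∀ K j ρ, GaugeInvariant (T♮ K j ρ)`).  CONDITIONAL ON THE
  A.E.-CLASS ONLY (for `k < K`, `ρ` integrable, and the transform of record a.e.-invariant under every coarse `v` — K0e's `transportOfRecord_comp_gaugeAct_ae_eq` supplies it for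
  lift-invariant `ρ`): `orbAvg_transportOfRecord_ae_eq` (the orbit average IS a version of the transform), `TinvOfRecord_ae_eq` (so is `T♮`), `isRT_TinvOfRecord` (a
  renormalisation transformation of `ρ`, [Balaban1985Averaging] (10)), `integrable_TinvOfRecord`, `regSet_orbAvg_eq` (same maximal regular set as the transform),
  `continuousOn_TinvOfRecord`, **`TinvOfRecord_eqOn_TcanOfRecord`** (`T♮ = TcanOfRecord` at EVERY point of `regSetOfRecord K k ρ` — nothing K0e's token reads on its regular set
  changes), `TinvOfRecord_eqOn_of_continuousOn` (pointwise determinacy wherever possible), and the lift-invariant-`ρ` corollaries `TinvOfRecord_ae_eq_of_liftInvariant` ∕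
  `isRT_TinvOfRecord_of_liftInvariant` ∕ `TinvOfRecord_eqOn_TcanOfRecord_of_liftInvariant`.
* §2 **LOCAL FAITHFULNESS `TinvOfRecord_ae_eq_on`**: for a measurable GAUGE-STABLE set `E` of coarse fields over which `ρ` is a.e.-lift-invariant (`ρ(U^{ṽ}) = ρ(U)` for a.e. `U`
  with `Ū ∈ E`), `T♮ρ = Tρ` a.e. ON `E` (companion module's `transportOfRecord_gaugeAct_ae_eq_on` + restricted orbit lemma) — the token is faithful to print's transform exactly
  where print lives (small-field ∕ solvable regions are gauge-stable), whatever the record's objects do on the complement (the documented junk corner off the solvable set).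

WHAT A RECORD GAINS by reading `T♮` (for the closability table; the adoption is the TYPE OWNER's one-token decision, NOT made here): every effective action `A_j`, `j ≥ 1`,
is gauge invariant EVERYWHERE BY CONSTRUCTION, so `HInvT` is unconditional and N09's member follows from [B11] Thm 1's three binders alone (dag-n09-w3 FILE 3
`thm3Member_of_indATPlug_of_invariantOutput`): (M1), (F7a), (F7b) leave N09's list.  HONEST CAVEAT (recorded, not hidden): `T♮ρ_k` is a version of print's transform of
`ρ_k` iff that transform is a.e.-invariant iff `ρ_k` is a.e.-lift-invariant iff the cut-off `χ_k` is ((M1) in a.e. currency) — so (M1-ae) does not disappear, it becomes the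
token's FAITHFULNESS ∕ `IsRT` face (`isRT_TinvOfRecord`'s hypothesis) and is cured only at the χ∕selection level (dag-n09-w2's item 2).  Off that hypothesis `T♮ρ` is the
transform of the Γ-average of `ρ`, not of `ρ`.

HONEST FRAMING: ONE definition + kernel-checked bookkeeping (K0e's `preimage_regSet_eq`, `canonVersion_comp_eqOn`, `canonVersion_eqOn_congr_ae`, `regSet_congr_ae`; the companion's a.e. lemmas);
nothing of Bałaban's asserted; no estimate; P7 ∕ (F7a) NOT discharged in any form; adopting `T♮` in a record is the type owner's call; counts unmoved (typed 28∕28 ·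
discharged 5∕27); one finite four-torus programme at fixed `ε = L^{−K}` — NOT continuum ∕ ℝ⁴ ∕ OS ∕ mass gap ∕ Clay.  No `sorry`, no `axiom`, no `instance`, no `notation`.
-/

noncomputable section

open MeasureTheory Set
open scoped BigOperators

namespace Literature.MathematicalPhysics.QuantumFieldTheory.Balaban1983to89.Node00

open _root_.Topology
open T4Continuum (T4Family)
open B12RTGaugeInvariance254 (LiftInvariant liftTransf invTransf invTransf_liftTransf avg_gaugeAct_liftTransf measurePreserving_gaugeAct measurable_gaugeAct
  gaugeAct_inv_gaugeAct gaugeAct_gaugeAct_inv isRT_comp_gaugeAct ae_eq_of_isRT integrable_comp_gaugeAct)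
open B12ContinuousTransportInvariance (continuous_gaugeAct)
open T3OrbitAverage (haarTransf orbAvg orbAvg_gaugeAct)
open T4AveragingDisintegration (integrable_kernelTransport)

/-! ## §1. At the record: the Γ-averaged canonical-version transport `TinvOfRecord` and its faces -/

section Record

variable (F : T4Family) (N : ℕ) [NeZero N]

/-- **THE Γ-AVERAGED CANONICAL-VERSION TRANSPORT OF RECORD `T♮`** (def-B's `Transport F N`; NO numerics, NO domain, NO proviso): per torus `K` and step `k`, the kernel
transform of record `transportOfRecord F N K k ρ` ([III] (3.1) read as the one-step disintegration) AVERAGED over the gauge group of `T^{(k+1)}` (so that it is gauge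
invariant at every point, for every `ρ` — print's symmetry of (0.13), [I] p. 254) and then replaced by its canonical version (continuous on the maximal open set on which
its a.e.-class has a continuous version, verbatim off it — K0e's canonicity). [cite: Balaban1987RG1, (0.13) p.254 and (0.19) p.255; Balaban1988Convergent, (3.1) p.264] -/
def TinvOfRecord : Transport F N :=
  fun K k ρ => canonVersion (piHaar (F.P K) (k + 1) (SU N)) (fun V => orbAvg (transportOfRecord F N K k ρ) V)

variable {F N}

/-- Unfolding (`rfl`). [cite: Balaban1987RG1, (0.13) p.254 (bookkeeping)] -/
theorem TinvOfRecord_apply (K k : ℕ) (ρ : Density (F.P K) k (SU N)) :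
    TinvOfRecord F N K k ρ =
      canonVersion (piHaar (F.P K) (k + 1) (SU N)) (fun V => orbAvg (transportOfRecord F N K k ρ) V) := rfl

/-- **`T♮` IS GAUGE INVARIANT AT EVERY POINT, FOR EVERY INPUT** — no integrability, no lift-invariance, no regular set in the hypotheses: the Γ-average `h` of the transform
is exactly invariant (`T3OrbitAverage.orbAvg_gaugeAct`); its maximal regular set is therefore gauge-stable (K0e `preimage_regSet_eq` at `h ∘ (·)^v = h`), the canonical version is
invariant ON it (K0e `canonVersion_comp_eqOn`) and is `h` verbatim OFF it. [cite: Balaban1987RG1, (0.13) p.254 («Tρ is gauge invariant also») and p.263] -/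
theorem TinvOfRecord_gaugeAct (K k : ℕ) (ρ : Density (F.P K) k (SU N)) (v : GaugeTransf (F.P K) (k + 1) (SU N)) (V : PBond (F.P K) (k + 1) → SU N) :
    TinvOfRecord F N K k ρ (GaugeField.gaugeAct v V) = TinvOfRecord F N K k ρ V := by
  haveI := isOpenPosMeasure_piHaar_SUN N (F.P K) (k + 1)
  have hΦc : Continuous (X := PBond (F.P K) (k + 1) → SU N) (Y := PBond (F.P K) (k + 1) → SU N) (GaugeField.gaugeAct v) :=
    continuous_gaugeAct v
  have hΨc : Continuous (X := PBond (F.P K) (k + 1) → SU N) (Y := PBond (F.P K) (k + 1) → SU N) (GaugeField.gaugeAct (invTransf v)) :=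
    continuous_gaugeAct (invTransf v)
  have hinv : (fun V : PBond (F.P K) (k + 1) → SU N => orbAvg (transportOfRecord F N K k ρ) V) ∘ GaugeField.gaugeAct v
      =ᵐ[piHaar (F.P K) (k + 1) (SU N)] fun V => orbAvg (transportOfRecord F N K k ρ) V :=
    Filter.Eventually.of_forall fun W => orbAvg_gaugeAct (transportOfRecord F N K k ρ) v W
  by_cases hV : V ∈ regSet (piHaar (F.P K) (k + 1) (SU N)) (fun V => orbAvg (transportOfRecord F N K k ρ) V)
  · exact canonVersion_comp_eqOn (μ := piHaar (F.P K) (k + 1) (SU N))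
      (f := fun V => orbAvg (transportOfRecord F N K k ρ) V) hΦc hΨc (measurePreserving_gaugeAct v)
      (measurePreserving_gaugeAct (invTransf v)) (gaugeAct_inv_gaugeAct v) (gaugeAct_gaugeAct_inv v) hinv hV
  · have hpre := preimage_regSet_eq (μ := piHaar (F.P K) (k + 1) (SU N))
      (f := fun V => orbAvg (transportOfRecord F N K k ρ) V) hΦc hΨc (measurePreserving_gaugeAct v)
      (measurePreserving_gaugeAct (invTransf v)) (gaugeAct_inv_gaugeAct v) (gaugeAct_gaugeAct_inv v) hinv
    have hV' : GaugeField.gaugeAct v V ∉ regSet (piHaar (F.P K) (k + 1) (SU N))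
        (fun V => orbAvg (transportOfRecord F N K k ρ) V) := by
      intro hmem
      have h' := congrArg (fun s : Set (PBond (F.P K) (k + 1) → SU N) => V ∈ s) hpre
      simp only [mem_preimage, eq_iff_iff] at h'
      exact hV (h'.1 hmem)
    calc TinvOfRecord F N K k ρ (GaugeField.gaugeAct v V)
        = orbAvg (transportOfRecord F N K k ρ) (GaugeField.gaugeAct v V) := canonVersion_eq_of_not_mem hV'
      _ = orbAvg (transportOfRecord F N K k ρ) V := orbAvg_gaugeAct (transportOfRecord F N K k ρ) v V
      _ = TinvOfRecord F N K k ρ V := (canonVersion_eq_of_not_mem hV).symm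

/-- **INVARIANT OUTPUT, `Transport`-hypothesis shape** (what dag-n09-w3 FILE 3 `…N09InvariantTransportPlug` consumes as `hT`): every image of `T♮` is a gauge-invariant
function of the coarse field. [cite: Balaban1987RG1, (0.13) p.254] -/
theorem gaugeInvariant_TinvOfRecord (K k : ℕ) (ρ : Density (F.P K) k (SU N)) : GaugeField.GaugeInvariant (TinvOfRecord F N K k ρ) :=
  fun v V => TinvOfRecord_gaugeAct K k ρ v V

/-- **THE Γ-AVERAGE OF THE TRANSFORM IS A VERSION OF THE TRANSFORM** whenever the transform is a.e.-invariant under every coarse gauge transformation (for `k < K` and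
integrable `ρ`: K0e's `transportOfRecord_comp_gaugeAct_ae_eq` gives this for LIFT-INVARIANT `ρ`; the a.e.-lift-invariant case is dag-n09-w3's Summits-side twin).
[cite: Balaban1987RG1, (0.13) p.254; Balaban1985Averaging, (11)–(13) p.19] -/
theorem orbAvg_transportOfRecord_ae_eq {K k : ℕ} (hk : k < K) {ρ : Density (F.P K) k (SU N)} (hρ : Integrable ρ (fieldMeasure (F.P K) k (SU N)))
    (hinv : ∀ v : GaugeTransf (F.P K) (k + 1) (SU N),
      (fun V => transportOfRecord F N K k ρ (GaugeField.gaugeAct v V)) =ᵐ[fieldMeasure (F.P K) (k + 1) (SU N)] transportOfRecord F N K k ρ) :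
    orbAvg (transportOfRecord F N K k ρ) =ᵐ[fieldMeasure (F.P K) (k + 1) (SU N)] transportOfRecord F N K k ρ :=
  have hi : Integrable (transportOfRecord F N K k ρ) (fieldMeasure (F.P K) (k + 1) (SU N)) :=
    integrable_kernelTransport (fieldMeasure (F.P K) k (SU N)) (fieldMeasure (F.P K) (k + 1) (SU N)) (avOfRecord_measurable F N K k)
      (avOfRecord_haarAC F N K k hk) hρ
  orbAvg_ae_eq_of_ae_invariant' hi.aestronglyMeasurable hinv

/-- **`T♮` IS A VERSION OF THE TRANSFORM OF RECORD** under the same a.e.-invariance (canonical version of a version). [cite: Balaban1987RG1, (0.13) p.254; Balaban1988Convergent, (3.1) p.264] -/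
theorem TinvOfRecord_ae_eq {K k : ℕ} (hk : k < K) {ρ : Density (F.P K) k (SU N)} (hρ : Integrable ρ (fieldMeasure (F.P K) k (SU N)))
    (hinv : ∀ v : GaugeTransf (F.P K) (k + 1) (SU N),
      (fun V => transportOfRecord F N K k ρ (GaugeField.gaugeAct v V)) =ᵐ[fieldMeasure (F.P K) (k + 1) (SU N)] transportOfRecord F N K k ρ) :
    (fun V : PBond (F.P K) (k + 1) → SU N => TinvOfRecord F N K k ρ V) =ᵐ[piHaar (F.P K) (k + 1) (SU N)]
      fun V => transportOfRecord F N K k ρ V :=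
  (canonVersion_ae_eq (μ := piHaar (F.P K) (k + 1) (SU N))).trans (orbAvg_transportOfRecord_ae_eq hk hρ hinv)

/-- **SAME MAXIMAL REGULAR SET**: under the a.e.-invariance the Γ-average and the transform have the same maximal regular open set (K0e `regSet_congr_ae`), i.e. `T♮` is
continuous exactly where `TcanOfRecord` is known to be. [cite: Balaban1987RG1, (0.13) p.254 (bookkeeping)] -/
theorem regSet_orbAvg_eq {K k : ℕ} (hk : k < K) {ρ : Density (F.P K) k (SU N)} (hρ : Integrable ρ (fieldMeasure (F.P K) k (SU N)))
    (hinv : ∀ v : GaugeTransf (F.P K) (k + 1) (SU N),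
      (fun V => transportOfRecord F N K k ρ (GaugeField.gaugeAct v V)) =ᵐ[fieldMeasure (F.P K) (k + 1) (SU N)] transportOfRecord F N K k ρ) :
    regSet (piHaar (F.P K) (k + 1) (SU N)) (fun V => orbAvg (transportOfRecord F N K k ρ) V) = regSetOfRecord F N K k ρ :=
  regSet_congr_ae (orbAvg_transportOfRecord_ae_eq hk hρ hinv)

/-- **`T♮ = TcanOfRecord` AT EVERY POINT OF THE MAXIMAL REGULAR SET** (under the a.e.-invariance): two canonical versions of the same a.e.-class agree on their common regular
set (K0e `canonVersion_eqOn_congr_ae`) — nothing K0e's token reads on `regSetOfRecord` changes. [cite: Balaban1987RG1, (0.13) p.254 and p.259] -/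
theorem TinvOfRecord_eqOn_TcanOfRecord {K k : ℕ} (hk : k < K) {ρ : Density (F.P K) k (SU N)} (hρ : Integrable ρ (fieldMeasure (F.P K) k (SU N)))
    (hinv : ∀ v : GaugeTransf (F.P K) (k + 1) (SU N),
      (fun V => transportOfRecord F N K k ρ (GaugeField.gaugeAct v V)) =ᵐ[fieldMeasure (F.P K) (k + 1) (SU N)] transportOfRecord F N K k ρ) :
    EqOn (TinvOfRecord F N K k ρ) (TcanOfRecord F N K k ρ) (regSetOfRecord F N K k ρ) := by
  haveI := isOpenPosMeasure_piHaar_SUN N (F.P K) (k + 1)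
  have h := canonVersion_eqOn_congr_ae (μ := piHaar (F.P K) (k + 1) (SU N)) (orbAvg_transportOfRecord_ae_eq hk hρ hinv)
  rw [regSet_orbAvg_eq hk hρ hinv] at h
  exact h

/-- **POINTWISE DETERMINACY WHEREVER POSSIBLE** (K0e's `TcanOfRecord_eqOn_of_continuousOn` for `T♮`, under the a.e.-invariance): on EVERY open set `U` of coarse fields on
which SOME a.e.-representative `g` of the transform of record is continuous — e.g. print's `𝐍_k·exp A_{k+1}` on its analyticity domain, IF that identity holds for the
record's objects — `T♮ K k ρ = g` at EVERY point of `U`. [cite: Balaban1987RG1, (0.19) p.255 and p.259] -/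
theorem TinvOfRecord_eqOn_of_continuousOn {K k : ℕ} (hk : k < K) {ρ : Density (F.P K) k (SU N)} (hρ : Integrable ρ (fieldMeasure (F.P K) k (SU N)))
    (hinv : ∀ v : GaugeTransf (F.P K) (k + 1) (SU N),
      (fun V => transportOfRecord F N K k ρ (GaugeField.gaugeAct v V)) =ᵐ[fieldMeasure (F.P K) (k + 1) (SU N)] transportOfRecord F N K k ρ)
    {U : Set (PBond (F.P K) (k + 1) → SU N)} (hU : IsOpen U) {g : (PBond (F.P K) (k + 1) → SU N) → ℝ} (hg : ContinuousOn g U)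
    (hae : g =ᵐ[(piHaar (F.P K) (k + 1) (SU N)).restrict U] fun V => transportOfRecord F N K k ρ V) : EqOn (TinvOfRecord F N K k ρ) g U := by
  haveI := isOpenPosMeasure_piHaar_SUN N (F.P K) (k + 1)
  have h2 : (fun V : PBond (F.P K) (k + 1) → SU N => transportOfRecord F N K k ρ V) =ᵐ[(piHaar (F.P K) (k + 1) (SU N)).restrict U]
      fun V => orbAvg (transportOfRecord F N K k ρ) V :=
    ae_restrict_of_ae (orbAvg_transportOfRecord_ae_eq hk hρ hinv).symm
  exact canonVersion_eqOn_of_continuousOn (μ := piHaar (F.P K) (k + 1) (SU N)) hU hg (hae.trans h2)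

/-- `T♮` is continuous on the maximal regular set of record (under the a.e.-invariance). [cite: Balaban1987RG1, (0.13) p.254 and p.259 (bookkeeping)] -/
theorem continuousOn_TinvOfRecord {K k : ℕ} (hk : k < K) {ρ : Density (F.P K) k (SU N)} (hρ : Integrable ρ (fieldMeasure (F.P K) k (SU N)))
    (hinv : ∀ v : GaugeTransf (F.P K) (k + 1) (SU N),
      (fun V => transportOfRecord F N K k ρ (GaugeField.gaugeAct v V)) =ᵐ[fieldMeasure (F.P K) (k + 1) (SU N)] transportOfRecord F N K k ρ) :
    ContinuousOn (fun V : PBond (F.P K) (k + 1) → SU N => TinvOfRecord F N K k ρ V) (regSetOfRecord F N K k ρ) := by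
  haveI := isOpenPosMeasure_piHaar_SUN N (F.P K) (k + 1)
  rw [← regSet_orbAvg_eq hk hρ hinv]
  exact continuousOn_canonVersion

/-- `IsRT` transfers along an a.e.-equality of the image (the push-forward identity reads the image under `∫ dV`). [cite: Balaban1985Averaging, (10) p.19 (bookkeeping)] -/
theorem isRT_congr_ae {P : Params} {j : ℕ} {avg : GaugeField P j (SU N) → GaugeField P (j + 1) (SU N)} {ρ : Density P j (SU N)}
    {ρ₁ ρ₂ : Density P (j + 1) (SU N)} (h : IsRT avg ρ ρ₁) (h12 : ρ₁ =ᵐ[fieldMeasure P (j + 1) (SU N)] ρ₂) : IsRT avg ρ ρ₂ := by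
  intro f hf hbd
  rw [← h f hf hbd]
  refine integral_congr_ae ?_
  filter_upwards [h12] with V hV
  rw [hV]

/-- **`T♮ρ` IS A RENORMALISATION TRANSFORMATION OF `ρ`** (`Setup.IsRT`) for `k < K`, `ρ` integrable, under the a.e.-invariance of the transform — the honest faithfulness
face of the token: WITHOUT that hypothesis `T♮ρ` is the transform of the Γ-average of `ρ`, not of `ρ`. [cite: Balaban1985Averaging, (10) p.19; Balaban1988Convergent, (3.1) p.264] -/
theorem isRT_TinvOfRecord {K k : ℕ} (hk : k < K) {ρ : Density (F.P K) k (SU N)} (hρ : Integrable ρ (fieldMeasure (F.P K) k (SU N)))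
    (hinv : ∀ v : GaugeTransf (F.P K) (k + 1) (SU N),
      (fun V => transportOfRecord F N K k ρ (GaugeField.gaugeAct v V)) =ᵐ[fieldMeasure (F.P K) (k + 1) (SU N)] transportOfRecord F N K k ρ) :
    IsRT (avOfRecord F N K k).avg ρ (TinvOfRecord F N K k ρ) :=
  isRT_congr_ae (isRT_transportOfRecord F N K k hk ρ hρ) (TinvOfRecord_ae_eq hk hρ hinv).symm

/-- Its images of integrable densities are integrable (under the a.e.-invariance). [cite: Balaban1988Convergent, (3.1) p.264 (bookkeeping)] -/
theorem integrable_TinvOfRecord {K k : ℕ} (hk : k < K) {ρ : Density (F.P K) k (SU N)} (hρ : Integrable ρ (fieldMeasure (F.P K) k (SU N)))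
    (hinv : ∀ v : GaugeTransf (F.P K) (k + 1) (SU N),
      (fun V => transportOfRecord F N K k ρ (GaugeField.gaugeAct v V)) =ᵐ[fieldMeasure (F.P K) (k + 1) (SU N)] transportOfRecord F N K k ρ) :
    Integrable (TinvOfRecord F N K k ρ) (fieldMeasure (F.P K) (k + 1) (SU N)) :=
  (integrable_kernelTransport (fieldMeasure (F.P K) k (SU N)) (fieldMeasure (F.P K) (k + 1) (SU N)) (avOfRecord_measurable F N K k)
      (avOfRecord_haarAC F N K k hk) hρ).congr (TinvOfRecord_ae_eq hk hρ hinv).symm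

/-! ### The lift-invariant-`ρ` corollaries (K0e's `transportOfRecord_comp_gaugeAct_ae_eq` supplies the a.e.-invariance of the transform) -/

/-- For `k < K` and `ρ` integrable and LIFT-INVARIANT, `T♮ρ` is a version of the transform of record. [cite: Balaban1987RG1, (0.13) p.254] -/
theorem TinvOfRecord_ae_eq_of_liftInvariant {K k : ℕ} (hk : k < K) {ρ : Density (F.P K) k (SU N)} (hρ : Integrable ρ (fieldMeasure (F.P K) k (SU N)))
    (hlift : LiftInvariant ρ) :
    (fun V : PBond (F.P K) (k + 1) → SU N => TinvOfRecord F N K k ρ V) =ᵐ[piHaar (F.P K) (k + 1) (SU N)] fun V => transportOfRecord F N K k ρ V :=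
  TinvOfRecord_ae_eq hk hρ fun v => transportOfRecord_comp_gaugeAct_ae_eq hk hρ hlift v

/-- … is a renormalisation transformation of `ρ`. [cite: Balaban1985Averaging, (10) p.19] -/
theorem isRT_TinvOfRecord_of_liftInvariant {K k : ℕ} (hk : k < K) {ρ : Density (F.P K) k (SU N)} (hρ : Integrable ρ (fieldMeasure (F.P K) k (SU N)))
    (hlift : LiftInvariant ρ) : IsRT (avOfRecord F N K k).avg ρ (TinvOfRecord F N K k ρ) :=
  isRT_TinvOfRecord hk hρ fun v => transportOfRecord_comp_gaugeAct_ae_eq hk hρ hlift v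

/-- … and agrees with K0e's `TcanOfRecord` at every point of `regSetOfRecord K k ρ`. [cite: Balaban1987RG1, (0.13) p.254 and p.259] -/
theorem TinvOfRecord_eqOn_TcanOfRecord_of_liftInvariant {K k : ℕ} (hk : k < K) {ρ : Density (F.P K) k (SU N)}
    (hρ : Integrable ρ (fieldMeasure (F.P K) k (SU N))) (hlift : LiftInvariant ρ) :
    EqOn (TinvOfRecord F N K k ρ) (TcanOfRecord F N K k ρ) (regSetOfRecord F N K k ρ) :=
  TinvOfRecord_eqOn_TcanOfRecord hk hρ fun v => transportOfRecord_comp_gaugeAct_ae_eq hk hρ hlift v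

end Record


/-! ## §2. LOCAL FAITHFULNESS: on a measurable gauge-stable set of coarse fields over which `ρ` is a.e.-lift-invariant, `T♮ρ = Tρ` a.e. ON it — the junk corner of the
record's objects (coarse fields OFF the solvable ∕ small-field region) drops out of the faithfulness face -/

section Local

variable {F : T4Family} {N : ℕ} [NeZero N]

/-- **LOCAL FAITHFULNESS OF `T♮`**: for `k < K`, `ρ` integrable, and a measurable gauge-stable set `E` of coarse fields over which `ρ` is a.e.-lift-invariant (`ρ(U^{ṽ}) = ρ(U)` for a.e.
`U` with `Ū ∈ E`), `T♮ρ = Tρ` `dV`-a.e. ON `E` — so `T♮` is faithful to print's transform EXACTLY WHERE print lives (small-field ∕ solvable regions are gauge-stable), whatever the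
record's objects do on the complement. [cite: Balaban1987RG1, (0.13) p.254, (2.1) p.265 and p.259; Balaban1988Convergent, (3.1) p.264] -/
theorem TinvOfRecord_ae_eq_on {K k : ℕ} (hk : k < K) {ρ : Density (F.P K) k (SU N)} (hρ : Integrable ρ (fieldMeasure (F.P K) k (SU N)))
    {E : Set (GaugeField (F.P K) (k + 1) (SU N))} (hE : MeasurableSet E)
    (hEst : ∀ (v : GaugeTransf (F.P K) (k + 1) (SU N)) (V : GaugeField (F.P K) (k + 1) (SU N)), GaugeField.gaugeAct v V ∈ E ↔ V ∈ E)
    (hinv : ∀ v : GaugeTransf (F.P K) (k + 1) (SU N), ∀ᵐ U ∂(fieldMeasure (F.P K) k (SU N)),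
      (avOfRecord F N K k).avg U ∈ E → ρ (GaugeField.gaugeAct (liftTransf v) U) = ρ U) :
    ∀ᵐ V ∂(fieldMeasure (F.P K) (k + 1) (SU N)), V ∈ E → TinvOfRecord F N K k ρ V = transportOfRecord F N K k ρ V := by
  have hT : Integrable (transportOfRecord F N K k ρ) (fieldMeasure (F.P K) (k + 1) (SU N)) :=
    integrable_kernelTransport (fieldMeasure (F.P K) k (SU N)) (fieldMeasure (F.P K) (k + 1) (SU N)) (avOfRecord_measurable F N K k)
      (avOfRecord_haarAC F N K k hk) hρ
  have horb := orbAvg_ae_eq_on_of_ae_invariant_on' hT.aestronglyMeasurable hE hEst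
    (fun v => transportOfRecord_gaugeAct_ae_eq_on hk hρ hE hEst hinv v)
  have hcan : (fun V : PBond (F.P K) (k + 1) → SU N => TinvOfRecord F N K k ρ V) =ᵐ[piHaar (F.P K) (k + 1) (SU N)]
      fun V => orbAvg (transportOfRecord F N K k ρ) V :=
    canonVersion_ae_eq (μ := piHaar (F.P K) (k + 1) (SU N))
  filter_upwards [horb, hcan] with V h1 h2 hV
  rw [h2, h1 hV]

end Local

end Literature.MathematicalPhysics.QuantumFieldTheory.Balaban1983to89.Node00

end
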